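import Literature.NumberTheory.EllipticCurves.KubertTateFiveEisensteinTwistMinimalModel
import Literature.NumberTheory.EllipticCurves.KubertTate4849ShaFive
import Literature.NumberTheory.EllipticCurves.LocalReductionKrausMinimality
import Literature.NumberTheory.EllipticCurves.ComplexMultiplicationLocalFactorsAux
import Literature.NumberTheory.EllipticCurves.RationalPointInfiniteOrderCriteria
import Mathlib.Tactic.NormNum.Prime
import HarnessLib

/-!
# The Eisenstein twist `E_{48/49}^{(-3)}` of a RANK-2 Kubert–Tate curve: RANK `1`, `t₅ = 0` unconditionally, on its minimal model
# `[1, 7049, −12, −546819, −89653119743]` (`rank E_{48/49}(ℚ(ζ₃)) = 3`) — CGLS input `corank_{ℤ₅} Sel_{5^∞} = 1`, `a₅ = 4 ≡ -1 (mod 5)`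

PROOF-ONLY file (theorems only, no definition, no named fact, no `sorry`), topic `NumberTheory/EllipticCurves`; a rank-`1` Eisenstein-twist row
whose base curve has RANK `2`: `E_{48/49} = [1, -2352, -115248, 0, 0]` (tree `KubertTate4849Descent`: rank `2`, full box with three points,
`Δ = -2²⁰·3⁵·7¹⁰·25969`, Eisenstein-tame: `25969 ≡ 4 (mod 5)`, `≡ 1 (mod 3)`; `mn = 2352 = 2⁴·3·7²`, `ω = 3`, `ω₂ = 1` since `7 ≡ 1 (mod 3)`),
so the descent over `ℚ(ζ₃)` sees `rank E(ℚ(ζ₃)) + 1 = 4 = ω + ω₂`: three from `ℚ` and one from the twist.  Through the CLASS-WIDE theorems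
`KubertTateEisensteinTwist.twist_door_of_le_rank_three` / `cgls_hypotheses_of_model`:

* `W = [1, 7049, −12, −546819, −89653119743]`, `⟨1, 2, −1/2, 5⟩ • W = E_{48/49}^{(-3)} = [0, 28221/4, 0, −518616, −89654185152]`; `W` globally
  minimal (`Δ_W = -2²⁰·3¹¹·7¹⁰·25969`, `2⁴ ∤ c₄ = 821318409`); rational point `P = (126701/25, 58155211/125)` (twist point `u = -42217/25`) with
  `5 ∣ den x(P)` ⟹ infinite order, `rank W(ℚ) ≥ 1 = ω₂`.
* `twist_48_49` — **`rank E_{48/49}^{(-3)}(ℚ) = 1`, `t₅(E_{48/49}^{(-3)}) = 0`, `t₅(E_{48/49}) = 0`**;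
* `cgls_hypotheses_48_49` — **`Good W 5 ∧ Red W 5 ∧ ¬ Anom W 5 ∧ corank_{ℤ₅} Sel_{5^∞}(W/ℚ) = 1 ∧ rank W(ℚ) = 1`** (`a₅(W) = -a₅(E) = 4`).

Transfer statement T (stmt-BirchSwinnertonDyer-22356) instrument; with CGLS Thm. E (`r = 1`) + GZK the Summits reading discharges T at `W`.  BSD is not
proved by this.

## References

* [SilvermanAEC2009] J. H. Silverman, *AEC*, 2nd ed., III.1 Table 3.1, VII.1 Remark 1.1, VII.3.4, VIII.6.7, X.§2, Exercise 10.16.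
* [Fisher2001FiveSevenDescent] T. Fisher, JEMS 3 (2001), §§1–2.
* [CastellaGrossiLeeSkinner2022] F. Castella, G. Grossi, J. Lee, C. Skinner, Invent. Math. 227 (2022), Thm. E.
* [Kraus1989] A. Kraus, *Quelques remarques à propos des invariants c₄, c₆ et Δ d'une courbe elliptique*, Prop. 2.
-/

noncomputable section

open scoped Classical
open WeierstrassCurve Literature.NumberTheory.EllipticCurves
open Literature.NumberTheory.EllipticCurves.Rank1Residual.X11RankOneCertificates (discOf c4Of c6Of)
open Literature.NumberTheory.EllipticCurves.Rank1Residual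

namespace Literature.NumberTheory.EllipticCurves

namespace KubertTate4849EisensteinTwist

/-! ## §1 The base curve `E_{48/49}`: Eisenstein tameness, `ω = 3`, `ω₂ = 1` -/

/-- **Eisenstein tameness of `E_{48/49}`**: bad primes `2, 3, 7, 25969 ≡ 2, 3, 2, 4 (mod 5)`; `25969 ≡ 1 (mod 3)`. [cite: Fisher2001FiveSevenDescent, §2] -/
theorem eisenstein_tame : ∀ ℓ : ℕ, ℓ.Prime → (ℓ : ℤ) ∣ (kubertTateFive (48 : ℤ) 49).Δ →
    ℓ % 5 ≠ 1 ∧ (ℓ % 5 = 4 → ℓ % 3 = 1) := by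
  intro p hp hdvd
  refine ⟨KubertTate4849Descent.tame p hp hdvd, fun h4 ↦ ?_⟩
  rw [KubertTate4849Descent.Δ_int] at hdvd
  have hdvdN : p ∣ 2 ^ 20 * 3 ^ 5 * 7 ^ 10 * 25969 := by
    have h' : (p : ℤ) ∣ ((2 ^ 20 * 3 ^ 5 * 7 ^ 10 * 25969 : ℕ) : ℤ) := by
      have e : ((2 ^ 20 * 3 ^ 5 * 7 ^ 10 * 25969 : ℕ) : ℤ) = 1869139921738172203008 := by norm_num
      rw [e]; exact (Int.dvd_neg.mpr hdvd)
    exact Int.natCast_dvd_natCast.mp h'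
  have hpi := Nat.Prime.prime hp
  rcases hpi.dvd_or_dvd hdvdN with h | h
  · rcases hpi.dvd_or_dvd h with h | h
    · rcases hpi.dvd_or_dvd h with h | h
      · have := (Nat.prime_dvd_prime_iff_eq hp Nat.prime_two).mp (hpi.dvd_of_dvd_pow h); omega
      · have := (Nat.prime_dvd_prime_iff_eq hp Nat.prime_three).mp (hpi.dvd_of_dvd_pow h); omega
    · have := (Nat.prime_dvd_prime_iff_eq hp (by norm_num : Nat.Prime 7)).mp (hpi.dvd_of_dvd_pow h); omega
  · have := (Nat.prime_dvd_prime_iff_eq hp (by norm_num : Nat.Prime 25969)).mp h; omega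

/-- `48` and `49` are coprime. [folklore] -/
private theorem isCoprime : IsCoprime (48 : ℤ) 49 := Int.isCoprime_iff_gcd_eq_one.mpr (by norm_num)

/-- `ω(2352) = 3` and `ω₂(2352) = 1` (`2352 = 2⁴·3·7²`, `7 ≡ 1 (mod 3)`). [folklore] -/
private theorem card_primeFactors :
    (((48 : ℤ) * 49).natAbs.primeFactors).card = 3 ∧ ((((48 : ℤ) * 49).natAbs.primeFactors.filter (fun ℓ ↦ ℓ % 3 = 1))).card = 1 := by
  have e : ((48 : ℤ) * 49).natAbs = 2 ^ 4 * 3 * 7 ^ 2 := by norm_num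
  rw [e, Nat.primeFactors_mul (by norm_num) (by norm_num), Nat.primeFactors_mul (by norm_num) (by norm_num),
    Nat.primeFactors_prime_pow (by norm_num) Nat.prime_two, Nat.Prime.primeFactors Nat.prime_three,
    Nat.primeFactors_prime_pow (by norm_num) (by norm_num : Nat.Prime 7)]
  exact ⟨by decide, by decide⟩

/-- The twist by `-3` is elliptic. [cite: SilvermanAEC2009, X.§2] -/
theorem isElliptic_twist :
    haveI := KubertTate4849Descent.isElliptic
    ((kubertTateFive (((48 : ℤ) : ℚ)) (((49 : ℤ) : ℚ))).quadraticTwist (-3)).IsElliptic := by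
  haveI := KubertTate4849Descent.isElliptic
  exact isElliptic_quadraticTwist _ (by norm_num)

/-! ## §2 The minimal model `W = [1, 7049, −12, −546819, −89653119743]` and its point -/

/-- **`E_{48/49}^{(-3)} = [0, 28221/4, 0, −518616, −89654185152]`** (`b₂ = -9407`, `b₄ = -115248`, `b₆ = 13282101504`). [cite: SilvermanAEC2009, X.§2] -/
theorem twist_eq : (kubertTateFive (((48 : ℤ) : ℚ)) (((49 : ℤ) : ℚ))).quadraticTwist (-3) =
    (⟨0, 28221 / 4, 0, -518616, -89654185152⟩ : WeierstrassCurve ℚ) := by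
  rw [KubertTate4849Descent.curve_eq]
  ext <;> simp [quadraticTwist, WeierstrassCurve.b₂, WeierstrassCurve.b₄, WeierstrassCurve.b₆] <;> norm_num

/-- **`⟨1, 2, −1/2, 5⟩ • W = E_{48/49}^{(-3)}`** for the integer model `W = [1, 7049, −12, −546819, −89653119743]`. [cite: SilvermanAEC2009, III.1 Table 3.1] -/
theorem variableChange_model :
    (⟨1, 2, -1 / 2, 5⟩ : VariableChange ℚ) •
        (⟨((1 : ℤ) : ℚ), ((7049 : ℤ) : ℚ), ((-12 : ℤ) : ℚ), ((-546819 : ℤ) : ℚ), ((-89653119743 : ℤ) : ℚ)⟩ : WeierstrassCurve ℚ) =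
      (kubertTateFive (((48 : ℤ) : ℚ)) (((49 : ℤ) : ℚ))).quadraticTwist (-3) := by
  rw [twist_eq]
  ext <;> simp [variableChange_a₁, variableChange_a₂, variableChange_a₃, variableChange_a₄, variableChange_a₆] <;> norm_num

/-- The model `W` is elliptic. [cite: SilvermanAEC2009, X.§2] -/
theorem isElliptic_model :
    (⟨((1 : ℤ) : ℚ), ((7049 : ℤ) : ℚ), ((-12 : ℤ) : ℚ), ((-546819 : ℤ) : ℚ), ((-89653119743 : ℤ) : ℚ)⟩ : WeierstrassCurve ℚ).IsElliptic := by
  refine ⟨isUnit_iff_ne_zero.mpr ?_⟩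
  norm_num [WeierstrassCurve.Δ, WeierstrassCurve.b₂, WeierstrassCurve.b₄, WeierstrassCurve.b₆, WeierstrassCurve.b₈]

/-- `Δ`, `c₄` of the integer model (kernel evaluation). [folklore] -/
private theorem invariants_model :
    discOf [1, 7049, -12, -546819, -89653119743] = -1362603002947127535992832 ∧ c4Of [1, 7049, -12, -546819, -89653119743] = 821318409 := by
  refine ⟨?_, ?_⟩ <;> decide

/-- **`W` is globally minimal**: `Δ_W = -2²⁰·3¹¹·7¹⁰·25969`; at `2`, `2⁴ ∤ c₄ = 821318409` (odd); no other `q¹² ∣ Δ`.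
[cite: SilvermanAEC2009, VII.1 Remark 1.1] [cite: Kraus1989, Prop. 2] -/
theorem isGloballyMinimal_model :
    (⟨((1 : ℤ) : ℚ), ((7049 : ℤ) : ℚ), ((-12 : ℤ) : ℚ), ((-546819 : ℤ) : ℚ), ((-89653119743 : ℤ) : ℚ)⟩ :
      WeierstrassCurve ℚ).IsGloballyMinimal := by
  obtain ⟨hD, hc4⟩ := invariants_model
  refine WeierstrassCurve.isGloballyMinimal_of_int_kraus 1 7049 (-12) (-546819) (-89653119743) fun q hq ↦ Or.inl fun h ↦ ?_
  obtain ⟨h12, h4⟩ := h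
  rw [hD] at h12
  rw [hc4] at h4
  have hq1 : (q : ℤ) ∣ 1362603002947127535992832 := Int.dvd_neg.mp (dvd_trans (dvd_pow_self _ (by norm_num)) h12)
  have hdvdN : q ∣ 2 ^ 20 * 3 ^ 11 * 7 ^ 10 * 25969 := by
    have e : ((2 ^ 20 * 3 ^ 11 * 7 ^ 10 * 25969 : ℕ) : ℤ) = 1362603002947127535992832 := by norm_num
    exact Int.natCast_dvd_natCast.mp (e ▸ hq1)
  have hpi := Nat.Prime.prime hq
  rcases hpi.dvd_or_dvd hdvdN with h | h
  · rcases hpi.dvd_or_dvd h with h | h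
    · rcases hpi.dvd_or_dvd h with h | h
      · have := (Nat.prime_dvd_prime_iff_eq hq Nat.prime_two).mp (hpi.dvd_of_dvd_pow h)
        subst this; revert h4; norm_num
      · have := (Nat.prime_dvd_prime_iff_eq hq Nat.prime_three).mp (hpi.dvd_of_dvd_pow h)
        subst this; revert h12; norm_num
    · have := (Nat.prime_dvd_prime_iff_eq hq (by norm_num : Nat.Prime 7)).mp (hpi.dvd_of_dvd_pow h)
      subst this; revert h12; norm_num
  · have := (Nat.prime_dvd_prime_iff_eq hq (by norm_num : Nat.Prime 25969)).mp h
    subst this; revert h12; norm_num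

/-- **The rational point `P = (126701/25, 58155211/125)` of `W`** (the twist point `(u, Y) = (-42217/25, 12993603/250)` of `E_{48/49}` moved to `W`;
`den x(P) = 5²`). [cite: SilvermanAEC2009, X.§2] -/
theorem nonsingular_P :
    (⟨((1 : ℤ) : ℚ), ((7049 : ℤ) : ℚ), ((-12 : ℤ) : ℚ), ((-546819 : ℤ) : ℚ), ((-89653119743 : ℤ) : ℚ)⟩ : WeierstrassCurve ℚ).toAffine.Nonsingular
      (126701 / 25) (58155211 / 125) := by
  haveI := isElliptic_model
  rw [← Affine.equation_iff_nonsingular, Affine.equation_iff]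
  push_cast
  norm_num

/-- **`rank W(ℚ) ≥ 1`**: `5 ∣ den x(P)` (Lutz–Nagell at the odd prime `5` on the globally minimal model; tree `one_le_mordellWeilRank_of_dvd_den`).
[cite: SilvermanAEC2009, VII.3.4 and Thm. VIII.6.7] -/
theorem one_le_mordellWeilRank_model :
    haveI := isElliptic_model
    1 ≤ (⟨((1 : ℤ) : ℚ), ((7049 : ℤ) : ℚ), ((-12 : ℤ) : ℚ), ((-546819 : ℤ) : ℚ), ((-89653119743 : ℤ) : ℚ)⟩ : WeierstrassCurve ℚ).mordellWeilRank := by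
  haveI := isElliptic_model
  haveI := isGloballyMinimal_model
  haveI : Fact (Nat.Prime 5) := ⟨Nat.prime_five⟩
  exact one_le_mordellWeilRank_of_dvd_den _ 5 (by norm_num) nonsingular_P (by norm_num)

/-! ## §3 Rank `1`, `t₅ = 0`, and the CGLS hypotheses — by the class-wide theorems -/

/-- **`rank E_{48/49}^{(-3)}(ℚ) = 1`, `t₅(E_{48/49}^{(-3)}/ℚ) = 0`, `t₅(E_{48/49}/ℚ) = 0` — unconditionally** (class-wide
`KubertTateEisensteinTwist.twist_door_of_le_rank_three`; full `ℚ`-box `rank E = 2 = ω − 1`, twist rank `≥ 1 = ω₂`; reference point `(336, 2016)`,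
good prime `11`). [cite: SilvermanAEC2009, Thm. X.4.2 and Exercise 10.16] [cite: Fisher2001FiveSevenDescent, §2] -/
theorem twist_48_49 :
    haveI := isElliptic_twist
    ((kubertTateFive (((48 : ℤ) : ℚ)) (((49 : ℤ) : ℚ))).quadraticTwist (-3)).mordellWeilRank = 1 ∧
      ((kubertTateFive (((48 : ℤ) : ℚ)) (((49 : ℤ) : ℚ))).quadraticTwist (-3)).shaCorank 5 = 0 ∧
      (kubertTateFive (((48 : ℤ) : ℚ)) (((49 : ℤ) : ℚ))).shaCorank 5 = 0 := by
  haveI := KubertTate4849Descent.isElliptic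
  haveI := isElliptic_twist
  haveI := isElliptic_model
  haveI : Fact (Nat.Prime 11) := ⟨by norm_num⟩
  have hP : (kubertTateFive (((48 : ℤ) : ℚ)) (((49 : ℤ) : ℚ))).toAffine.Nonsingular 336 2016 :=
    (KubertTate4849Descent.nonsingular_iff _ _).mpr (by norm_num)
  obtain ⟨hω, hω₂⟩ := card_primeFactors
  have hr : ((48 : ℤ) * 49).natAbs.primeFactors.card ≤ (kubertTateFive (((48 : ℤ) : ℚ)) (((49 : ℤ) : ℚ))).mordellWeilRank + 1 := by
    rw [hω, KubertTate4849Descent.mordellWeilRank_eq]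
  have hr' : (((48 : ℤ) * 49).natAbs.primeFactors.filter (fun ℓ ↦ ℓ % 3 = 1)).card ≤
      ((kubertTateFive (((48 : ℤ) : ℚ)) (((49 : ℤ) : ℚ))).quadraticTwist (-3)).mordellWeilRank := by
    rw [hω₂, ← KubertTateEisensteinTwist.mordellWeilRank_of_model 48 49 _ _ variableChange_model]
    exact one_le_mordellWeilRank_model
  obtain ⟨ht, hE, hrk⟩ := KubertTateEisensteinTwist.twist_door_of_le_rank_three 48 49 KubertTate4849Descent.not_five_dvd_Δ
    eisenstein_tame hP (by norm_num) (by norm_num) 11 (by norm_num) (by norm_num) KubertTate4849Descent.not_tor_dvd_Δ hr hr'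
  exact ⟨by rw [hrk, hω₂], ht, hE⟩

/-- **THE CGLS INPUT AT `W`, from the class-wide theorem**: `Good W 5`, `Red W 5`, `¬ Anom W 5` (`a₅(W) = -a₅(E_{48/49}) = 4`),
**`corank_{ℤ₅} Sel_{5^∞}(W/ℚ) = 1`** and `rank W(ℚ) = 1`. [cite: CastellaGrossiLeeSkinner2022, Thm. E (r = 1)] [cite: SilvermanAEC2009, Exercise 10.16] -/
theorem cgls_hypotheses_48_49 :
    haveI := isGloballyMinimal_model
    haveI := isElliptic_model
    haveI : Fact (Nat.Prime 5) := ⟨Nat.prime_five⟩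
    Good (⟨((1 : ℤ) : ℚ), ((7049 : ℤ) : ℚ), ((-12 : ℤ) : ℚ), ((-546819 : ℤ) : ℚ), ((-89653119743 : ℤ) : ℚ)⟩ : WeierstrassCurve ℚ) 5 ∧
      Red (⟨((1 : ℤ) : ℚ), ((7049 : ℤ) : ℚ), ((-12 : ℤ) : ℚ), ((-546819 : ℤ) : ℚ), ((-89653119743 : ℤ) : ℚ)⟩ : WeierstrassCurve ℚ) 5 ∧
      ¬ Anom (⟨((1 : ℤ) : ℚ), ((7049 : ℤ) : ℚ), ((-12 : ℤ) : ℚ), ((-546819 : ℤ) : ℚ), ((-89653119743 : ℤ) : ℚ)⟩ : WeierstrassCurve ℚ) 5 ∧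
      (⟨((1 : ℤ) : ℚ), ((7049 : ℤ) : ℚ), ((-12 : ℤ) : ℚ), ((-546819 : ℤ) : ℚ), ((-89653119743 : ℤ) : ℚ)⟩ : WeierstrassCurve ℚ).selmerCorank 5 = 1 ∧
      (⟨((1 : ℤ) : ℚ), ((7049 : ℤ) : ℚ), ((-12 : ℤ) : ℚ), ((-546819 : ℤ) : ℚ), ((-89653119743 : ℤ) : ℚ)⟩ : WeierstrassCurve ℚ).mordellWeilRank = 1 := by
  haveI := KubertTate4849Descent.isElliptic
  haveI := isElliptic_twist
  haveI := isElliptic_model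
  haveI := isGloballyMinimal_model
  haveI : Fact (Nat.Prime 5) := ⟨Nat.prime_five⟩
  haveI : Fact (Nat.Prime 11) := ⟨by norm_num⟩
  have hP : (kubertTateFive (((48 : ℤ) : ℚ)) (((49 : ℤ) : ℚ))).toAffine.Nonsingular 336 2016 :=
    (KubertTate4849Descent.nonsingular_iff _ _).mpr (by norm_num)
  obtain ⟨hω, hω₂⟩ := card_primeFactors
  have hr : ((48 : ℤ) * 49).natAbs.primeFactors.card ≤ (kubertTateFive (((48 : ℤ) : ℚ)) (((49 : ℤ) : ℚ))).mordellWeilRank + 1 := by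
    rw [hω, KubertTate4849Descent.mordellWeilRank_eq]
  have hr' : (((48 : ℤ) * 49).natAbs.primeFactors.filter (fun ℓ ↦ ℓ % 3 = 1)).card ≤
      ((kubertTateFive (((48 : ℤ) : ℚ)) (((49 : ℤ) : ℚ))).quadraticTwist (-3)).mordellWeilRank := by
    rw [hω₂, ← KubertTateEisensteinTwist.mordellWeilRank_of_model 48 49 _ _ variableChange_model]
    exact one_le_mordellWeilRank_model
  have h := KubertTateEisensteinTwist.cgls_hypotheses_of_model 48 49 isCoprime KubertTate4849Descent.not_five_dvd_Δ eisenstein_tame hP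
    (by norm_num) (by norm_num) 11 (by norm_num) (by norm_num) KubertTate4849Descent.not_tor_dvd_Δ hr hr' _ _ variableChange_model
  rw [hω₂] at h
  exact h

end KubertTate4849EisensteinTwist

end Literature.NumberTheory.EllipticCurves

end
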